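import Summits.HodgeConjecture.HodgeConjecture.Theses.DerivedTorelliFermat
import Summits.HodgeConjecture.HodgeConjecture.Theses.GaloisSieve
import Literature.AlgebraicGeometry.HodgeTheory.HypersurfaceLefschetzUpper

/-!
# Shared support `HypersurfaceLefschetz` (item stmt-HodgeConjecture-11281; routes DerivedTorelliFermat, GaloisSieve)

The support item `HypersurfaceLefschetz` — for a smooth hypersurface `Y ⊂ ℙⁿ⁺¹_ℂ` of dimension `n`
and every `0 < p < n` with `2p ≠ n`, `algebraicClasses Y p = ⊤` — is VERBATIM the tree's named fact
`Voisin2003_smoothHypersurface_algebraicClasses_eq_top` (Lefschetz's theorem on hyperplane sections,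
Voisin II Cor. 1.24/1.25), which is DISCHARGED in the tree
(`Voisin2003_smoothHypersurface_algebraicClasses_eq_top_holds`, file `HypersurfaceLefschetzUpper`).
Both route decls (`DerivedTorelliFermat.HypersurfaceLefschetz`, `GaloisSieve.HypersurfaceLefschetz`)
have the same body; both are closed here.  No named-fact hypothesis, no sorry.
-/

-- `Summit.HodgeConjecture.HodgeConjecture.Theorems` is the mandated namespace (single-problem
-- summit: Problem = Summit), which `linter.dupNamespace` flags on every declaration; the lakefile
-- turns the linter off tree-wide (weak option), restated here so stand-alone elaboration is
-- warning-free too.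
set_option linter.dupNamespace false

namespace Summit.HodgeConjecture.HodgeConjecture.Theorems

/-- **Item stmt-HodgeConjecture-11281 (`HypersurfaceLefschetz`), route `DerivedTorelliFermat` decl**:
Lefschetz's theorem for smooth hypersurfaces off the middle degree — the tree's discharged named fact
`Voisin2003_smoothHypersurface_algebraicClasses_eq_top_holds`.
[cite: VoisinHodgeII2003, Thm. 1.23, Cor. 1.24 and Cor. 1.25] -/
theorem derivedTorelliFermat_hypersurfaceLefschetz_proof :
    Summit.HodgeConjecture.HodgeConjecture.Theses.DerivedTorelliFermat.HypersurfaceLefschetz :=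
  Literature.AlgebraicGeometry.HodgeTheory.Voisin2003_smoothHypersurface_algebraicClasses_eq_top_holds

/-- **Item stmt-HodgeConjecture-11281 (`HypersurfaceLefschetz`), route `GaloisSieve` decl** (same
body as the `DerivedTorelliFermat` decl): the tree's discharged named fact
`Voisin2003_smoothHypersurface_algebraicClasses_eq_top_holds`.
[cite: VoisinHodgeII2003, Thm. 1.23, Cor. 1.24 and Cor. 1.25] -/
theorem galoisSieve_hypersurfaceLefschetz_proof :
    Summit.HodgeConjecture.HodgeConjecture.Theses.GaloisSieve.HypersurfaceLefschetz :=
  Literature.AlgebraicGeometry.HodgeTheory.Voisin2003_smoothHypersurface_algebraicClasses_eq_top_holds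

end Summit.HodgeConjecture.HodgeConjecture.Theorems
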